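import Summits.HodgeConjecture.HodgeConjecture.Theorems.F0P3XiPacketFamilyOfRecordUnram   -- ★ `ramOfRecord₂`, `good_of_not_mem_ramOfRecord₂` (conjunct `μω.IsUnramifiedAt w`)
import Summits.HodgeConjecture.HodgeConjecture.Theorems.K2LiuA7ValueSocketHuRamified       -- ★ `isUnramifiedAt_quadraticHeckeCharCM_iff_of_nonsplit` (`ε_v` unramified ↔ `v` unramified, non-split `v`)
import Literature.NumberTheory.Automorphic.AsaiAtOneRankOne                                -- ★ `HeckeCharacter.isUnramifiedAt_restrict`, ★ `HeightOneSpectrum.ramificationIdxIn_eq_one_of_smul_ne`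
import Literature.NumberTheory.Automorphic.ClassFieldCharacterFrobenius                    -- ★ `isUnramifiedIn_of_ramificationIdxIn_eq_one`
import Literature.NumberTheory.Automorphic.PairLFunctionBaseChange                         -- ★ `finite_placesOver`
import Literature.NumberTheory.Automorphic.QuadraticLocalBaseChange                        -- ★ `PlacesOver.nonempty`
import Literature.NumberTheory.GaloisRepresentations.FrobeniusDensityTheorem               -- ★ `finite_setOf_not_isUnramifiedIn` (the finite set `Ram(L∕L⁺)`)
import HarnessLib

/-!
# R90-TF · S7 (Ch. 14.6-tuple, C146) · «`ramOfRecord₂ ξ ⊇ Ram(L∕L⁺)` UNDER `μ|𝔸_{L⁺}^× = ε_{L∕L⁺}`» — the kernel form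
# ([Rogawski1990, §4.8 p. 51 «μ|F* = ω_{E∕F}»; §12.1 p. 171; §12.2 (2) pp. 173–174; §14.6 p. 242]; [NeukirchANT1999, Ch. V §1 (1.2)])

Cell `hodgecm-mathlib`, crux H413 (`stmt-HodgeConjecture-24833`), route of record `HCCMUnconditional`; programme R90-TF (brief
`director/R90-BRIEF.v2.md` 1f40d54518340a35), section S7 = Rogawski §14.6 (base `R90-C146`), seat R90-C146-p01 (g2), default (D1) of the seat's UP
(R90 bus 2026-09-04T23:5xZ; no S7 dealer seat UP).  Helper file, lane `--supports stmt-HodgeConjecture-24833 --as helper`; THEOREMS ONLY (no definition,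
no instance, no notation, no `sorry`); ★-only imports (L9: no `Cruxes/…/Lines` import).

WHY.  LH7-audit1 (g2) CAUTION 2026-09-04T23:21:34Z («do NOT plan on `v ∉ ramOfRecord₂ ξ ⇒ HUR v` — `good₂` carries `μω.IsUnramifiedAt`, not
`IsUnramifiedIn`; the implication is local CFT and NO ★ lemma exists») and LH7-typ2 (g2) PRECISION #2 23:29:02Z («`ramOfRecord₂ ξ ⊇ Ram(L∕L⁺)` is a SEMANTIC
containment for the record's `(μω, keys)` under `hμω` … NO ★ kernel lemma `v ∉ ramOfRecord₂ ξ → Algebra.IsUnramifiedIn (𝓞 L) v.asIdeal` exists»).  This file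
IS that kernel lemma.  With it every `ramOfRecord₂`-guarded S7 row (S7 B `εOfRecord_eq_one_of_not_mem_ramOfRecord₂` ∕ `prod_εOfRecord_eq_prod_ramOfRecord₂` ∕
`signProduct_of_formSignOffRam`, ★ `R90.S7.formSignOffRam`, leaf (k)) is «J-RAM-3-safe» (LEAD #36 (B)) by a NAMED fact, and the HUR guard token of (R-39)″ ∕ S4 A
ED. 3 v3.1 :208 — `Algebra.IsUnramifiedIn (𝓞 L) v.asIdeal` — is available at every `v ∉ ramOfRecord₂ ξ` (alternative to `RamL` in leaf ED. 7; audit1's road stands).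

THE MATHEMATICS (one paragraph).  Let `μ` be a Hecke character of the CM field `L` with `μ(x_L) = ε_{L∕L⁺}(x)` on `𝕀_{L⁺}` (`hμω`, print's standing
«`μ|_{I_F} = ω_{E∕F}`», [Rogawski1990, §4.8 p. 51, §12.1 p. 171]) and let `v` be a finite place of `L⁺` with `μ` unramified at every `w ∣ v`.  For `u ∈ 𝒪_vˣ`,
`(⟨u⟩_v)_L = ∏_{w ∣ v} ⟨u⟩_w` with `|u|_w = 1`, so `ε(⟨u⟩_v) = ∏_w μ(⟨u⟩_w) = 1`: `ε` is unramified at `v` (★ `HeckeCharacter.isUnramifiedAt_restrict`).  If `v` is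
NON-SPLIT this forces `v` unramified in `L∕L⁺`, since `ε_v` is ramified at a ramified place (`(𝒪_vˣ : N 𝒪_wˣ) = e = 2`, ★ `isUnramifiedAt_quadraticHeckeCharCM_iff_of_nonsplit`,
CFT-free); if `v` is SPLIT it is unramified anyway (`g·e·f = 2`, `g = 2`; ★ `ramificationIdxIn_eq_one_of_smul_ne`).  The record's exceptional set `ramOfRecord₂ ξ`
contains every `v` with some `w ∣ v` at which `μω` is ramified (★ `good_of_not_mem_ramOfRecord₂`, conjunct 3), whence §2–§3.

CONTENTS.  §1 `isUnramifiedIn_of_forall_placesOver_isUnramifiedAt` (record-free) · §2 `isUnramifiedIn_of_not_mem_ramOfRecord₂`,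
`mem_ramOfRecord₂_of_not_isUnramifiedIn` · §3 `ramifiedPlaces_subset_ramOfRecord₂` (`RamL ⊆ ramOfRecord₂ ξ`, `RamL := (finite_setOf_not_isUnramifiedIn L⁺ L).toFinset`).

HONEST LABEL: a count-neutral helper; it pays no socket and no citation.  HC_CM is proved only modulo the 7 printed citations (2 remaining named inputs: hLiu418 =
stmt-HodgeConjecture-24832, h413 = stmt-HodgeConjecture-24833) — until rung 0 closes.

## References
* [Rogawski1990] J. D. Rogawski, *Automorphic Representations of Unitary Groups in Three Variables*, Ann. of Math. Stud. 123 (1990): §4.8 p. 51 («`μ|F* = ω_{E∕F}`»),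
  §12.1 p. 171, §12.2 (2) pp. 173–174, §14.6 p. 242.
* [NeukirchANT1999] J. Neukirch, *Algebraic Number Theory*, Grundlehren 322 (1999): Ch. V §1 (1.2) (`(U_K : N U_L) = e`), Ch. VII §6 (6.10)–(6.11) (conductor).
* [CasselsFrohlichANT1967] J. W. S. Cassels, A. Fröhlich (eds.), *Algebraic Number Theory* (1967): Ch. II §11, Ch. VII §1.2 (places above `v` in a Galois extension).
* [TateThesis1967] J. Tate, *Fourier analysis in number fields and Hecke's zeta-functions* (1967), §2.3, §4.3 (local components, unramified characters).
-/

set_option autoImplicit false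
-- the mandated namespace repeats the single-problem summit's segment (`HodgeConjecture.HodgeConjecture`)
set_option linter.dupNamespace false

noncomputable section

open NumberField IsDedekindDomain MeasureTheory
open scoped Matrix MatrixGroups

namespace Summit.HodgeConjecture.HodgeConjecture.R90.S7

open Literature.NumberTheory Literature.NumberTheory.Automorphic Literature.NumberTheory.Automorphic.UnitaryGroup
open Literature.NumberTheory.Rogawski1990 Literature.NumberTheory.GaloisRepresentations
open Summit.HodgeConjecture.HodgeConjecture.Cruxes.H413
open Summit.HodgeConjecture.HodgeConjecture.Cruxes.H413.F0P3XiPacketFamilyOfRecord (ramOfRecord₂ good_of_not_mem_ramOfRecord₂)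
open Summit.HodgeConjecture.HodgeConjecture.Cruxes.HLiu418.K2LiuA7ValueSocketHuRamified (isUnramifiedAt_quadraticHeckeCharCM_iff_of_nonsplit)

/-! ## §1 The record-free lemma: `μ|𝔸_{L⁺}^× = ε_{L∕L⁺}` and `μ` unramified above `v` force `v` unramified in `L∕L⁺` -/

/-- **`μ|_{𝕀_{L⁺}} = ε_{L∕L⁺}` AND `μ` UNRAMIFIED AT EVERY `w ∣ v` ⇒ `v` IS UNRAMIFIED IN `L∕L⁺`.**  For a Hecke character `μ` of the CM field `L` whose
restriction to `𝕀_{L⁺}` is the quadratic character `ε_{L∕L⁺}` (print's standing hypothesis «`μ|_{I_F} = ω_{E∕F}`») and a finite place `v` of `L⁺` such that `μ` is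
unramified at every place `w` of `L` above `v`, the place `v` is unramified in `L` (Mathlib `Algebra.IsUnramifiedIn (𝓞 L) v.asIdeal`).  Non-split `v`: `ε` is then
unramified at `v` (restriction below unramified places), impossible at a ramified place where `(𝒪_vˣ : N 𝒪_wˣ) = 2`; split `v`: `e = 1` as `g e f = 2`, `g = 2`.
[cite: Rogawski1990, §4.8 p. 51; §12.1 p. 171] [cite: NeukirchANT1999, Ch. V §1 (1.2)] [cite: CasselsFrohlichANT1967, Ch. VII §1.2] -/
theorem isUnramifiedIn_of_forall_placesOver_isUnramifiedAt (L : Type) [Field L] [NumberField L] [IsCMField L] {μ : HeckeCharacter L}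
    (hμω : ∀ x : ideleGroup ↥(maximalRealSubfield L), μ (AdeleRing.ideleBaseChange (↥(maximalRealSubfield L)) L x) = quadraticHeckeCharCM L x)
    {v : HeightOneSpectrum (𝓞 ↥(maximalRealSubfield L))} (hv : ∀ w : PlacesOver L v, μ.IsUnramifiedAt w.1) :
    Algebra.IsUnramifiedIn (𝓞 L) v.asIdeal := by
  classical
  obtain ⟨w⟩ := (inferInstance : Nonempty (PlacesOver L v))
  by_cases hw : IsCMField.complexConj L • w.1 = w.1
  · -- NON-SPLIT `v`: `ε` is unramified at `v` by restriction, and the dichotomy at a non-split place concludes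
    have hfin : {w' : HeightOneSpectrum (𝓞 L) | w'.under (𝓞 ↥(maximalRealSubfield L)) = v}.Finite :=
      Set.finite_coe_iff.mp (finite_placesOver (F := ↥(maximalRealSubfield L)) (E := L) v)
    have hε : (quadraticHeckeCharCM L).IsUnramifiedAt v :=
      HeckeCharacter.isUnramifiedAt_restrict (F := ↥(maximalRealSubfield L)) (E := L) (χ := μ) (χ₀ := quadraticHeckeCharCM L)
        (fun x => (hμω x).symm) hfin.toFinset (fun w' => by rw [Set.Finite.mem_toFinset, Set.mem_setOf_eq]) fun w' hw' => hv ⟨w', hw'⟩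
    exact (isUnramifiedAt_quadraticHeckeCharCM_iff_of_nonsplit L v w hw).mp hε
  · -- SPLIT `v`: `e(v) = 1` because `c • w ≠ w` gives two places above `v` in the quadratic extension `L ∕ L⁺`
    have h2 : Module.finrank ↥(maximalRealSubfield L) L = 2 := Algebra.IsQuadraticExtension.finrank_eq_two ↥(maximalRealSubfield L) L
    have he := (HeightOneSpectrum.ramificationIdxIn_eq_one_of_smul_ne (F := ↥(maximalRealSubfield L)) (E := L) h2 hw).1
    rw [w.2] at he
    exact isUnramifiedIn_of_ramificationIdxIn_eq_one (F := ↥(maximalRealSubfield L)) (L := L) he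

/-! ## §2 The record form: off `ramOfRecord₂ ξ` the place is unramified in `L∕L⁺` (under `hμω`) -/

section Record

variable (L : Type) [Field L] [NumberField L] [IsCMField L] (H : Matrix (Fin 3) (Fin 3) L)
  (hH : (H.map (cmConjRingHom L))ᵀ = H) (hHd : IsUnit H.det) (μω : HeckeCharacter L)
  (hμω : ∀ x : ideleGroup ↥(maximalRealSubfield L), μω (AdeleRing.ideleBaseChange (↥(maximalRealSubfield L)) L x) = quadraticHeckeCharCM L x)
  [∀ v : HeightOneSpectrum (𝓞 ↥(maximalRealSubfield L)), MeasurableSpace (Gqs L v ⧸ Subgroup.center (Gqs L v))]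
  (μZ : ∀ v : HeightOneSpectrum (𝓞 ↥(maximalRealSubfield L)), Measure (Gqs L v ⧸ Subgroup.center (Gqs L v)))
  (keys : ∀ (ξ : OneDimAutRepH L) (v : HeightOneSpectrum (𝓞 ↥(maximalRealSubfield L))),
    (∀ w : PlacesOver L v, IsCMField.complexConj L • w.1 = w.1) →
      {p : IrrClass (Gqs L v) × IrrClass (Gqs L v) //
        KeysCaseTwoLabels L v (μω.semilocalComponent L v) (torusLocalComponent L (IsCMField.complexConj L) v ξ.η)
          (torusLocalComponent L (IsCMField.complexConj L) v ξ.ψ) p.1 p.2 ∧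
        p.1.IsSquareIntegrable (μZ v) ∧ ¬ p.2.IsSquareIntegrable (μZ v)})
  (ξ : OneDimAutRepH L)
  {hexc : ∀ᶠ v : HeightOneSpectrum (𝓞 ↥(maximalRealSubfield L)) in Filter.cofinite,
    ∀ hns : ∀ w : PlacesOver L v, IsCMField.complexConj L • w.1 = w.1,
      ((keys ξ v hns).1.2).IsSpherical (cmLocalIntegralLevel L 3 (qsForm L) v)}

include hμω in
/-- **OFF `ramOfRecord₂ ξ` THE PLACE IS UNRAMIFIED IN `L∕L⁺`** (under `hμω : μ|_{𝕀_{L⁺}} = ε_{L∕L⁺}`): `v ∉ ramOfRecord₂ ξ → Algebra.IsUnramifiedIn (𝓞 L) v.asIdeal`.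
A good place has `μω` unramified at every `w ∣ v` (★ `good_of_not_mem_ramOfRecord₂`, conjunct 3 of the first clause), and §1 applies.  This is the KERNEL form of
«`ramOfRecord₂ ξ ⊇ Ram(L∕L⁺)`» for the record's `μω` — the HUR guard token `Algebra.IsUnramifiedIn (𝓞 L) v.asIdeal` at every `v ∉ ramOfRecord₂ ξ`.
[cite: Rogawski1990, §12.2 (2) pp. 173–174; §4.8 p. 51; §14.6 p. 242] [cite: NeukirchANT1999, Ch. V §1 (1.2)] -/
theorem isUnramifiedIn_of_not_mem_ramOfRecord₂ {v : HeightOneSpectrum (𝓞 ↥(maximalRealSubfield L))}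
    (hv : v ∉ ramOfRecord₂ L H hH hHd μω μZ keys ξ hexc) : Algebra.IsUnramifiedIn (𝓞 L) v.asIdeal :=
  isUnramifiedIn_of_forall_placesOver_isUnramifiedAt L hμω fun w => ((good_of_not_mem_ramOfRecord₂ L H hH hHd μω μZ keys ξ hv).1 w).2.2.1

include hμω in
/-- **A PLACE RAMIFIED IN `L∕L⁺` LIES IN `ramOfRecord₂ ξ`** (under `hμω`): the contrapositive of `isUnramifiedIn_of_not_mem_ramOfRecord₂`.
[cite: Rogawski1990, §12.2 (2) pp. 173–174; §4.8 p. 51] [cite: NeukirchANT1999, Ch. V §1 (1.2)] -/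
theorem mem_ramOfRecord₂_of_not_isUnramifiedIn {v : HeightOneSpectrum (𝓞 ↥(maximalRealSubfield L))}
    (hram : ¬ Algebra.IsUnramifiedIn (𝓞 L) v.asIdeal) : v ∈ ramOfRecord₂ L H hH hHd μω μZ keys ξ hexc :=
  by_contra fun hv => hram (isUnramifiedIn_of_not_mem_ramOfRecord₂ L H hH hHd μω hμω μZ keys ξ hv)

/-! ## §3 `RamL ⊆ ramOfRecord₂ ξ` as finsets -/

include hμω in
/-- **`Ram(L∕L⁺) ⊆ ramOfRecord₂ ξ`** (under `hμω`), with `Ram(L∕L⁺)` the finite set of finite places of `L⁺` ramified in `L` (★ `finite_setOf_not_isUnramifiedIn L⁺ L`,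
the `RamL` of LH7-audit1 (g2) 2026-09-04T23:21:34Z (B)): `(finite_setOf_not_isUnramifiedIn L⁺ L).toFinset ⊆ ramOfRecord₂ ξ`.
[cite: Rogawski1990, §12.2 (2) pp. 173–174; §14.6 p. 242] [cite: NeukirchANT1999, Ch. V §1 (1.2)] -/
theorem ramifiedPlaces_subset_ramOfRecord₂ :
    (finite_setOf_not_isUnramifiedIn ↥(maximalRealSubfield L) L).toFinset ⊆ ramOfRecord₂ L H hH hHd μω μZ keys ξ hexc := by
  intro v hv
  rw [Set.Finite.mem_toFinset, Set.mem_setOf_eq] at hv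
  exact mem_ramOfRecord₂_of_not_isUnramifiedIn L H hH hHd μω hμω μZ keys ξ hv

end Record

end Summit.HodgeConjecture.HodgeConjecture.R90.S7

end
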